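import Literature.Algebra.Homology.LaurentCechFree
import Mathlib.Algebra.Homology.ShortComplex.ModuleCat
import Mathlib.RingTheory.Finiteness.Basic
import Mathlib.Data.Int.Interval
import HarnessLib

/-!
# The Čech cohomology of a free graded module over `A[x₀, …, x_r]` is finitely generated

Consequences of the cone contraction of `Literature/Algebra/Homology/LaurentCechFree` for the
degree-`d` Čech complex `Č_d(F)` (`LaurentCech.cech e ⊤ d`) of the free graded module
`F = ⊕_{j ∈ J} P(-e_j)` over `P = A[x₀, …, x_r]`, `A` any commutative ring — Serre's computation of the
cohomology of the twisting sheaves on projective space (Hartshorne III Thm. 5.1; Stacks Project,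
Tag 01XT: `H^i(𝐏^r_A, 𝒪(n)) = 0` for `0 < i < r`, `H^r(𝐏^r_A, 𝒪(n))` free on the monomials
`x^m`, all `m_i < 0`, `|m| = n`), in the form needed for Serre's finiteness theorem:

* `LaurentCech.exactAt_cech_top`, `isZero_homology_cech_top_of_lt` — **`H^i(Č_d(F)) = 0` for
  `0 < i < r`** (a cocycle `c` is `d(h c)`);
* `LaurentCech.eq_d_hom_add_topCochain`, `moduleFinite_homology_cech_top_top` — every top cochain is a
  coboundary plus a combination of the finitely many (`finite_topIndex`) monomials `x^m e_j` of degree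
  `d` with all exponents negative, so **`H^r(Č_d(F))` is finitely generated**;
* `LaurentCech.isZero_homology_cech_of_lt` — `H^i(Č_d(K)) = 0` for `i > r` and ANY `K` (no
  `(r+1)`-simplices);
* `LaurentCech.moduleFinite_homology_cech_top` — **`H^i(Č_d(F))` is a finitely generated `A`-module for
  every `i ≥ 1`**, the base case of the descending induction of Hartshorne III Thm. 5.2 (a)
  (`Literature/Algebra/Homology/SerreFiniteness`).

Also two small lemmas on short complexes of modules used throughout: `moduleFinite_of_isZero` and
`moduleFinite_homology_of_repr` (finiteness of `H` of a short complex of modules from a finitely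
generated module of representatives of the cycles modulo boundaries, via Mathlib's
`ShortComplex.moduleCatHomologyIso`). Everything is proved. Mathlib searched (pin v4.32):
`ShortComplex.moduleCatHomologyIso`, `HomologicalComplex.homologyIsoSc'`, `HomologicalComplex.exactAt_iff'`,
`ShortComplex.moduleCat_exact_iff` (used); no cohomology of projective space.

## References

* R. Hartshorne, *Algebraic Geometry*, GTM 52, Springer (1977): III Thm. 5.1 (p. 225) and its proof.
  [Hartshorne1977]
* The Stacks Project, Tag 01XT (Cohomology of Schemes, Lemma 30.8.1). [StacksProject]
-/

noncomputable section

open Finset AddMonoidAlgebra CategoryTheory CategoryTheory.Limits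

universe u

namespace Literature.Algebra.Homology

namespace LaurentCech

open OrderedCech

variable {A : Type u} [CommRing A] {r : ℕ} {J : Type}

/-! ### Two finiteness lemmas for short complexes of modules -/

/-- A zero object of `ModuleCat A` is a finitely generated module. [folklore] -/
theorem moduleFinite_of_isZero {M : ModuleCat.{u} A} (h : IsZero M) : Module.Finite A M := by
  haveI : Subsingleton M := ModuleCat.subsingleton_of_isZero h
  exact Module.Finite.of_surjective (0 : A →ₗ[A] M) fun x => ⟨0, Subsingleton.elim _ _⟩

/-- **Finiteness of the homology of a short complex of modules from a finitely generated module of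
representatives**: if every cycle of `S` is `φ t + f y` with `t` in a finitely generated module `T`
(and `φ` lands in the cycles), then `H(S)` is finitely generated. [folklore] -/
theorem moduleFinite_homology_of_repr (S : ShortComplex (ModuleCat.{u} A)) {T : Type u}
    [AddCommGroup T] [Module A T] [Module.Finite A T] (φ : T →ₗ[A] S.X₂)
    (hφ : ∀ t, S.g (φ t) = 0) (h : ∀ x : S.X₂, S.g x = 0 → ∃ (t : T) (y : S.X₁), x = φ t + S.f y) :
    Module.Finite A S.homology := by
  -- `H(S) ≅ ker g ⧸ im (X₁ → ker g)`
  let e := S.moduleCatHomologyIso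
  haveI : Module.Finite A S.moduleCatLeftHomologyData.H := by
    rw [ShortComplex.moduleCatLeftHomologyData_H]
    let ψ : T →ₗ[A] LinearMap.ker S.g.hom ⧸ LinearMap.range S.moduleCatToCycles :=
      (LinearMap.range S.moduleCatToCycles).mkQ ∘ₗ LinearMap.codRestrict _ φ fun t => hφ t
    refine Module.Finite.of_surjective ψ fun z => ?_
    obtain ⟨⟨x, hx⟩, rfl⟩ := Submodule.mkQ_surjective _ z
    obtain ⟨t, y, hxy⟩ := h x hx
    refine ⟨t, ?_⟩
    change (LinearMap.range S.moduleCatToCycles).mkQ _ = (LinearMap.range S.moduleCatToCycles).mkQ _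
    rw [← sub_eq_zero, ← map_sub, Submodule.mkQ_apply, Submodule.Quotient.mk_eq_zero]
    refine ⟨-y, Subtype.ext ?_⟩
    change S.f (-y) = φ t - x
    rw [map_neg, hxy]
    abel
  exact Module.Finite.equiv e.symm.toLinearEquiv

/-! ### Vanishing above the top degree (any family) -/

section AnyFamily

variable (e : J → ℤ) (K : Submodule (P A r) (J → P A r)) (d : ℤ)

/-- The Čech complex `Č_d(K)` vanishes in degrees `> r` (there are `r + 1` variables). [folklore] -/
theorem isZero_cech_X_of_lt (i : ℤ) (hi : (r : ℤ) < i) : IsZero ((cech e K d).X i) :=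
  isZero_complex_X_of_card_le _ _ i (by rw [Fintype.card_fin]; omega)

/-- Hence `H^i(Č_d(K)) = 0` for `i > r`. [folklore] -/
theorem isZero_homology_cech_of_lt (i : ℤ) (hi : (r : ℤ) < i) : IsZero ((cech e K d).homology i) :=
  (HomologicalComplex.exactAt_iff_isZero_homology _ _).mp
    (HomologicalComplex.ExactAt.of_isZero (isZero_cech_X_of_lt e K d i hi))

/-- The Čech complex `Č_d(K)` vanishes in negative degrees. [folklore] -/
theorem isZero_cech_X_of_neg (i : ℤ) (hi : i < 0) : IsZero ((cech e K d).X i) :=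
  isZero_complex_X_of_neg _ _ i hi

/-- The differentials of `Č_d(K)` are the ordered Čech differentials. [folklore] -/
theorem cech_d (i : ℤ) :
    (cech e K d).d i (i + 1) = ModuleCat.ofHom (OrderedCech.d _ (locDeg_mono e K d) i) :=
  complex_d _ _ i

end AnyFamily

/-! ### The cohomology of the free graded module -/

section Free

variable (e : J → ℤ) (d : ℤ)

/-- Above the top degree `r` there is only the zero cochain. [folklore] -/
theorem subsingleton_cochain_top (p : ℤ) (hp : (r : ℤ) + 1 ≤ p) :
    Subsingleton (Cochain (freeFam A r e d) p) := by
  haveI : IsEmpty (Simplex (Fin (r + 1)) p) :=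
    isEmpty_simplex_of_card_le (by rw [Fintype.card_fin]; omega)
  infer_instance

variable [Finite J]

/-- **Exactness of `Č_d(F)` in the degrees `1, …, r - 1`** for the free graded module `F`: a cocycle
`c` equals `d (h c)` by the homotopy identity (Stacks Project, Tag 01XT: `H^i(𝐏^r, 𝒪(c)) = 0` for
`0 < i < r`). [folklore] -/
theorem exactAt_cech_top (p : ℤ) (hp : 0 ≤ p) (hpr : p + 1 < r) :
    (cech e (⊤ : Submodule (P A r) (J → P A r)) d).ExactAt (p + 1) := by
  rw [HomologicalComplex.exactAt_iff' _ (p + 1) (i := p) (k := p + 1 + 1) (by simp) (by simp),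
    ShortComplex.moduleCat_exact_iff]
  intro x hx
  refine ⟨hom e d p x, ?_⟩
  change ((cech e ⊤ d).d p (p + 1)) (hom e d p x) = x
  change ((cech e ⊤ d).d (p + 1) (p + 1 + 1)) x = 0 at hx
  rw [cech_d] at hx ⊢
  change OrderedCech.d _ (freeFam_mono e d) (p + 1) x = 0 at hx
  change OrderedCech.d _ (freeFam_mono e d) p (hom e d p x) = x
  have key := d_hom_add_hom_d e d hp x
  rw [hx, map_zero, add_zero, if_neg (by omega), sub_zero] at key
  exact key

/-- `H^{p+1}(Č_d(F)) = 0` for `0 ≤ p`, `p + 1 < r`. [folklore] -/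
theorem isZero_homology_cech_top_of_lt (p : ℤ) (hp : 0 ≤ p) (hpr : p + 1 < r) :
    IsZero ((cech e (⊤ : Submodule (P A r) (J → P A r)) d).homology (p + 1)) :=
  (HomologicalComplex.exactAt_iff_isZero_homology _ _).mp (exactAt_cech_top e d p hp hpr)

/-- The index set of the top cohomology: pairs `(j, m)` with `x^m e_j` of degree `d` and all
exponents of `m` negative (`H^r(𝐏^r, 𝒪(c))` is free on the monomials `x^m` with all `m_i < 0`,
Stacks Project, Tag 01XT). [folklore] -/
def TopIndex : Type := {s : J × Expt r // edeg r s.2 = d - e s.1 ∧ ∀ i, s.2 i < 0}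

/-- Exponent vectors of fixed total degree with all entries negative form a finite set. [folklore] -/
theorem finite_setOf_edeg_eq_and_neg (c : ℤ) : {m : Expt r | edeg r m = c ∧ ∀ i, m i < 0}.Finite := by
  refine Set.Finite.subset (Set.Finite.pi (t := fun _ : Fin (r + 1) => Set.Icc c (-1))
    fun _ => Set.finite_Icc _ _) ?_
  rintro m ⟨hdeg, hneg⟩ i -
  refine ⟨?_, by have := hneg i; omega⟩
  -- `c = Σ_l m_l ≤ m_i` since the other entries are negative
  rw [← hdeg, edeg_apply, ← Finset.add_sum_erase _ _ (Finset.mem_univ i)]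
  have : ∑ l ∈ Finset.univ.erase i, m l ≤ 0 :=
    Finset.sum_nonpos fun l _ => (hneg l).le
  omega

/-- The index set of the top cohomology is finite. [folklore] -/
instance finite_topIndex : Finite (TopIndex (r := r) e d) := by
  have hfin : {s : J × Expt r | edeg r s.2 = d - e s.1 ∧ ∀ i, s.2 i < 0}.Finite := by
    refine Set.Finite.subset (Set.Finite.prod (Set.finite_univ (α := J))
      (Set.Finite.biUnion (Set.finite_univ (α := J))
        fun j _ => finite_setOf_edeg_eq_and_neg (r := r) (d - e j))) ?_
    rintro ⟨j, m⟩ ⟨h1, h2⟩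
    exact ⟨Set.mem_univ _, Set.mem_biUnion (Set.mem_univ j) ⟨h1, h2⟩⟩
  exact hfin.to_subtype

/-- The top simplex `{0, …, r}`, of dimension `r`. [folklore] -/
def topSimplex (p : ℤ) (hpr : p + 1 = r) : Simplex (Fin (r + 1)) (p + 1) :=
  ⟨Finset.univ, Finset.univ_nonempty, by rw [Finset.card_univ, Fintype.card_fin]; omega⟩

/-- Every simplex of dimension `r` is the top simplex. [folklore] -/
theorem simplex_top_eq (p : ℤ) (hpr : p + 1 = r) (σ : Simplex (Fin (r + 1)) (p + 1)) :
    σ.1 = Finset.univ :=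
  Finset.eq_univ_of_card _ (by have := σ.2.2; rw [Fintype.card_fin]; omega)

variable [DecidableEq J]

/-- The index set of the top cohomology as a finite type. [folklore] -/
instance fintype_topIndex : Fintype (TopIndex (r := r) e d) := Fintype.ofFinite _

/-- The vector `Σ_{(j,m)} f(j,m) x^m e_j ∈ L^n` attached to a coefficient function on the top index
set. [folklore] -/
def topVec (f : TopIndex (r := r) e d → A) : J → L A r := fun j =>
  ∑ s : TopIndex e d, if s.1.1 = j then f s • AddMonoidAlgebra.single s.1.2 1 else 0

/-- Coefficients of `topVec f`. [folklore] -/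
theorem coeff_topVec (f : TopIndex (r := r) e d → A) (j : J) (m : Expt r) :
    (topVec e d f j).coeff m =
      if h : edeg r m = d - e j ∧ ∀ i, m i < 0 then f ⟨(j, m), h⟩ else 0 := by
  classical
  rw [topVec, AddMonoidAlgebra.coeff_sum, Finset.sum_apply']
  have hterm : ∀ s : TopIndex e d, ((if s.1.1 = j then f s • AddMonoidAlgebra.single s.1.2 1
      else 0 : L A r).coeff m : A) = if s.1 = (j, m) then f s else 0 := by
    intro s
    by_cases hs : s.1 = (j, m)
    · rw [if_pos hs, if_pos (by rw [hs]), AddMonoidAlgebra.coeff_smul, AddMonoidAlgebra.coeff_single,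
        Finsupp.smul_apply, show s.1.2 = m by rw [hs], Finsupp.single_eq_same, smul_eq_mul, mul_one]
    · rw [if_neg hs]
      split_ifs with hj
      · rw [AddMonoidAlgebra.coeff_smul, AddMonoidAlgebra.coeff_single, Finsupp.smul_apply,
          Finsupp.single_eq_of_ne, smul_zero]
        intro hm; apply hs; ext <;> simp [hj, hm]
      · rfl
  simp_rw [hterm]
  split_ifs with h
  · rw [Finset.sum_eq_single ⟨(j, m), h⟩]
    · simp
    · intro s _ hs
      rw [if_neg]
      intro h'
      exact hs (Subtype.ext h')
    · intro h'; exact absurd (Finset.mem_univ _) h'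
  · refine Finset.sum_eq_zero fun s _ => ?_
    rw [if_neg]
    intro hs
    apply h
    have := s.2
    rw [hs] at this
    exact this

/-- `topVec f` lies in every member of the free family over the top simplex. [folklore] -/
theorem topVec_mem (f : TopIndex (r := r) e d → A) :
    topVec e d f ∈ freeFam A r e d Finset.univ := by
  rw [mem_locDeg_top_iff]
  intro j m hm
  rw [coeff_topVec] at hm
  split_ifs at hm with h
  · exact ⟨h.1, fun i hi => absurd (Finset.mem_univ i) hi⟩
  · exact absurd rfl hm

/-- The cochains of top degree attached to coefficient functions on the top index set, a linear
map `A^{TopIndex} → Č^r_d(F)`. [folklore] -/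
def topCochain (p : ℤ) (hpr : p + 1 = r) :
    (TopIndex (r := r) e d → A) →ₗ[A] Cochain (freeFam A r e d) (p + 1) where
  toFun f σ := ⟨topVec e d f, by rw [simplex_top_eq p hpr σ]; exact topVec_mem e d f⟩
  map_add' f g := by
    funext σ; apply Subtype.ext; funext j
    refine AddMonoidAlgebra.ext (Finsupp.ext fun m => ?_)
    change (topVec e d (f + g) j).coeff m = (topVec e d f j + topVec e d g j).coeff m
    rw [AddMonoidAlgebra.coeff_add, Finsupp.add_apply, coeff_topVec, coeff_topVec, coeff_topVec]
    split_ifs <;> simp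
  map_smul' a f := by
    funext σ; apply Subtype.ext; funext j
    refine AddMonoidAlgebra.ext (Finsupp.ext fun m => ?_)
    change (topVec e d (a • f) j).coeff m = (a • topVec e d f j).coeff m
    rw [AddMonoidAlgebra.coeff_smul, Finsupp.smul_apply, coeff_topVec, coeff_topVec]
    split_ifs <;> simp

/-- Coefficients of `topCochain f`. [folklore] -/
theorem coef_topCochain (p : ℤ) (hpr : p + 1 = r) (f : TopIndex (r := r) e d → A)
    (σ : Simplex (Fin (r + 1)) (p + 1)) (j : J) (m : Expt r) :
    coef (topCochain e d p hpr f) σ.1 j m =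
      if h : edeg r m = d - e j ∧ ∀ i, m i < 0 then f ⟨(j, m), h⟩ else 0 := by
  rw [coef_val]
  exact coeff_topVec e d f j m

/-- **Every top cochain is a coboundary plus a combination of the monomials with all exponents
negative**: `c = d (h c) + topCochain (γ(c))`. [folklore] -/
theorem eq_d_hom_add_topCochain (p : ℤ) (hp : 0 ≤ p) (hpr : p + 1 = r)
    (c : Cochain (freeFam A r e d) (p + 1)) :
    c = OrderedCech.d _ (freeFam_mono e d) p (hom e d p c) +
      topCochain e d p hpr fun s => coef c Finset.univ s.1.1 s.1.2 := by
  have key := d_hom_add_hom_d e d hp c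
  haveI : Subsingleton (Cochain (freeFam A r e d) (p + 1 + 1)) :=
    subsingleton_cochain_top e d _ (by omega)
  rw [Subsingleton.elim (OrderedCech.d _ (freeFam_mono e d) (p + 1) c) 0, map_zero, add_zero,
    if_pos hpr] at key
  rw [key, sub_add_eq_add_sub, eq_sub_iff_add_eq, add_right_inj]
  -- `pnone c = topCochain (γ c)`
  apply coef_ext
  intro σ j m
  rw [coef_topCochain, coef_pnone]
  have hσ := simplex_top_eq p hpr σ
  by_cases hpiv : pivot m = ⊥
  · rw [if_pos hpiv]
    have hneg := pivot_eq_bot_iff.mp hpiv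
    by_cases hdeg : edeg r m = d - e j
    · rw [dif_pos ⟨hdeg, hneg⟩, hσ]
    · rw [dif_neg fun h => hdeg h.1, coef_val]
      by_contra hne
      have := (mem_locDeg_top_iff e).mp (c σ).2 j m hne
      exact hdeg this.1
  · rw [if_neg hpiv, dif_neg]
    intro h
    exact hpiv (pivot_eq_bot_iff.mpr h.2)

/-- **The top cohomology `H^r(Č_d(F))` of the free graded module is finitely generated**: it is
generated by the classes of the finitely many monomials `x^m e_j` of degree `d` with all `m_i < 0`
(Stacks Project, Tag 01XT; Hartshorne III.5.1 (c)). [folklore] -/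
theorem moduleFinite_homology_cech_top_top (p : ℤ) (hp : 0 ≤ p) (hpr : p + 1 = r) :
    Module.Finite A ((cech e (⊤ : Submodule (P A r) (J → P A r)) d).homology (p + 1)) := by
  let K := cech e (⊤ : Submodule (P A r) (J → P A r)) d
  let S := K.sc' p (p + 1) (p + 1 + 1)
  haveI : Module.Finite A S.homology := by
    refine moduleFinite_homology_of_repr S (ModuleCat.ofHom (topCochain e d p hpr)).hom ?_ ?_
    · intro t
      exact @Subsingleton.elim _ (subsingleton_cochain_top e d (p + 1 + 1) (by omega)) _ _
    · intro (x : Cochain (freeFam A r e d) (p + 1)) _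
      refine ⟨fun s => coef x Finset.univ s.1.1 s.1.2, hom e d p x, ?_⟩
      have hd : S.f = ModuleCat.ofHom (OrderedCech.d _ (locDeg_mono e ⊤ d) p) := cech_d e ⊤ d p
      rw [hd]
      change x = topCochain e d p hpr _ + OrderedCech.d _ (freeFam_mono e d) p (hom e d p x)
      exact (eq_d_hom_add_topCochain e d p hp hpr x).trans (add_comm _ _)
  exact Module.Finite.equiv
    (K.homologyIsoSc' p (p + 1) (p + 1 + 1) (by simp) (by simp)).symm.toLinearEquiv

omit [DecidableEq J] in
/-- **The Čech cohomology of a free graded module over `A[x₀, …, x_r]` is finitely generated in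
all positive degrees** (and zero except in degree `r`): the algebraic form of Serre's computation
`H^i(𝐏^r_A, ⊕_j 𝒪(d - e_j))`, `i ≥ 1` (Stacks Project, Tag 01XT; Hartshorne, *Algebraic Geometry*,
III.5.1). No hypothesis on the commutative ring `A` is needed. [folklore] -/
theorem moduleFinite_homology_cech_top (i : ℤ) (hi : 1 ≤ i) :
    Module.Finite A ((cech e (⊤ : Submodule (P A r) (J → P A r)) d).homology i) := by
  classical
  by_cases h1 : i < r
  · obtain ⟨p, rfl⟩ : ∃ p, i = p + 1 := ⟨i - 1, by ring⟩
    exact moduleFinite_of_isZero (isZero_homology_cech_top_of_lt e d p (by omega) h1)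
  · by_cases h2 : i = r
    · obtain ⟨p, rfl⟩ : ∃ p, i = p + 1 := ⟨i - 1, by ring⟩
      exact moduleFinite_homology_cech_top_top e d p (by omega) h2
    · exact moduleFinite_of_isZero (isZero_homology_cech_of_lt e ⊤ d i (by omega))

end Free

end LaurentCech

end Literature.Algebra.Homology
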